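import Summits.AtomisticToContinuum.BoseEinsteinCondensation.Theorems.BECRewardDescentRewardChordBoundRewardedPositivity
import Summits.AtomisticToContinuum.BoseEinsteinCondensation.Theorems.BECRewardDescentRewardChordBoundZeroMomentumIntegrable
import Summits.AtomisticToContinuum.BoseEinsteinCondensation.Theorems.BECConjugateDominationHardCoreExtensionMaxFormApproximationFiniteRange
import Summits.AtomisticToContinuum.BoseEinsteinCondensation.Theorems.BECConjugateDominationHardCoreExtensionUniformTruncationGapOfSimple
import Summits.AtomisticToContinuum.BoseEinsteinCondensation.Theorems.BECConjugateDominationHardCoreExtensionWeightedLogGradientBoundTools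
-- module: Summits.AtomisticToContinuum.BoseEinsteinCondensation.Theorems.BECRewardDescentRewardChordBoundRewardedClassFRHelpers

/-!
# The rewarded maximal-form ground-state class for finite-range potentials, hard cores allowed — helper file
# (crux `RewardChordBound`, stmt-AtomisticToContinuum-12876, stub R1 `stub_rewardedClassFR`)

Hard-core twin of the INTEGRABLE rewarded kit (`…RewardedGroundStates`, `…RewardedPositivity`,
`…ZeroMomentumIntegrable`): for a repulsive finite-range pair profile `v` (hard cores `v = ⊤` and
non-integrable singularities allowed), `L > 0`, `s ≥ 0` and a level `R ∈ [0, ∞)` we study the class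

  `𝓜 = {η ∈ boseSymmetric N | maxFormR s v L η ≤ R ‖η‖²}`,  `maxFormR = maxForm + s·dep`,

of `L²((ℝ/ℤ)^{3N})` (Haar probability measure). Everything the integrable kit derived from `W ∈ L¹(cell)` is
re-derived here from two hard-core inputs of crux `HardCoreExtension`:

* the MaxFormApproximation `stub_maxFormApproximationFiniteRange` (free embedding `ι₀`), which gives the
  **rewarded maximal-form bound** `R(s)‖ξ‖² ≤ maxFormR s v L ξ` on the Bose sector for the `C¹` rewarded infimum
  `R(s) = inf_Ψ (E_v[Ψ] + s(N - n₀(Ψ)))` (`iInf_rewarded_mul_le_maxFormR`), via the depletion dictionary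
  `N - n₀(Ψ) = dep(ι₀Ψ)` and the `L²`-Lipschitz bound of the depletion;
* the truncation trick `maxForm v = ⨆ₘ maxForm (min(v,m))` (`maxForm_eq_iSup_truncPotential`), which gives the
  **lower semicontinuity of the rewarded maximal form** along `L²`-convergent sequences without `W ∈ L¹`
  (`maxFormR_le_of_tendsto_fr`), hence closedness of `𝓜` (and, with Rellich through the FREE form domain,
  the compactness of rewarded near-minimising sequences of the sequel file `…RewardedClassFR.lean`).

Given the bound (as a hypothesis `hbound`) the class `𝓜` is a `ℂ`-subspace closed under `|·|`, `conj`,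
diagonal translations, it is closed, and the rewarded Euler–Lagrange identity
`KinB(η,ξ) + PotB(η,ξ) + s·DepB(η,ξ) = R re⟪η,ξ⟫` holds at its elements (`toReal_maxForm_add_smul_c2`).

References: [ReedSimonIV1978] §XIII.12, Thms XIII.43–44, XIII.64; [Simon1979Forms] Thm. 2.1; [FarisSimon1975].
-/

noncomputable section

open MeasureTheory Filter Set Complex UnitAddTorus
open scoped ENNReal NNReal Topology InnerProductSpace ComplexConjugate
open Literature.Analysis.FunctionSpaces Literature.Analysis.OperatorTheory Literature.Analysis.InnerProduct

namespace Summit.AtomisticToContinuum.BoseEinsteinCondensation.Cruxes.RewardChordBound.Birth.RewardedClassFR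

open Literature.MathematicalPhysics.QuantumManyBody.BoseGas
open Summit.AtomisticToContinuum.BoseEinsteinCondensation.Cruxes.StaticResponseBound.UvThomsonForceWave
  (measurable_zeroProfile lintegral_periodicInteraction_zero_ne_top)
open Summit.AtomisticToContinuum.BoseEinsteinCondensation.Cruxes.HardCoreExtension.ThirdLawCurrentFloorAlt
  (maxForm_eq_iSup_truncPotential lintegral_cellN_periodicInteraction_truncPotential_ne_top
    maxForm_formEmbed_free_trialState toReal_maxForm_add_smul_c2)
open Summit.AtomisticToContinuum.BoseEinsteinCondensation.Cruxes.HardCoreExtension.NearMinTower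
  (stub_maxFormApproximationFiniteRange)
open Summit.AtomisticToContinuum.BoseEinsteinCondensation.Cruxes.RewardChordBound.Birth.RewardedGroundStates
  (maxFormR_compLp_le)
open Summit.AtomisticToContinuum.BoseEinsteinCondensation.Cruxes.RewardChordBound.Birth.RewardedPositivity
  (toReal_maxFormR maxFormR_ne_top_of_maxForm_ne_top)
open Summit.AtomisticToContinuum.BoseEinsteinCondensation.Cruxes.RewardChordBound.Birth.ZeroMomentumIntegrable
  (maxFormR_le_of_tendsto' maxFormR_absLp_le maxFormR_translateLp)
open Summit.AtomisticToContinuum.BoseEinsteinCondensation.Cruxes.RewardChordBound.Birth.DepletionDictionary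
  (natCast_sub_condensateOccupation_eq_ofReal_depletion)

-- The measure on `ℝ/ℤ` is the Haar PROBABILITY measure, as in `PeriodicFormDomain.lean`.
attribute [local instance] Literature.MathematicalPhysics.QuantumManyBody.BoseGas.formDomain_measureSpace
  Literature.MathematicalPhysics.QuantumManyBody.BoseGas.formDomain_isProbabilityMeasure
  Literature.MathematicalPhysics.QuantumManyBody.BoseGas.formDomain_isProbabilityMeasure_pi

variable {N : ℕ} {L : ℝ} {v : ℝ → ℝ≥0∞} {s : ℝ}

/-- Local notation for the Hilbert space `L²((ℝ/ℤ)^{3N})`, as in `PeriodicFormDomain.lean`. -/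
local notation "L2T " N':max => Lp ℂ 2 (volume : Measure (UnitAddTorus (Fin N' × Fin 3)))

/-! ### Part A — the rewarded maximal form without `W ∈ L¹`: truncation, lower semicontinuity, dictionary -/

/-- The maximal forms of the truncations `min(v, m)` are at most that of `v`. [folklore] -/
theorem maxForm_truncPotential_le (hv : Measurable v) (L : ℝ) (m : ℕ) (η : L2T N) :
    maxForm (truncPotential v m) L η ≤ maxForm v L η := by
  rw [maxForm_eq_iSup_truncPotential hv L η]
  exact le_iSup (fun m => maxForm (truncPotential v m) L η) m

/-- The rewarded maximal form is the monotone limit of those of the truncations. [folklore] -/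
theorem maxFormR_eq_iSup_truncPotential (hv : Measurable v) (s : ℝ) (L : ℝ) (η : L2T N) :
    maxFormR s v L η = ⨆ m : ℕ, maxFormR s (truncPotential v m) L η := by
  simp only [maxFormR_def]
  rw [maxForm_eq_iSup_truncPotential hv L η, ENNReal.iSup_add]

/-- **Lower semicontinuity of the rewarded maximal form, hard cores allowed**: if `xⱼ → η` in `L²` and
`maxFormR xⱼ ≤ cⱼ → C`, then `maxFormR η ≤ C` (each truncation `min(v, m)` is integrable on the cell, where
`maxFormR_le_of_tendsto'` applies; then monotone convergence in `m`). [folklore] -/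
theorem maxFormR_le_of_tendsto_fr (hv : IsRepulsiveFiniteRange v) (hL : 0 < L) {x : ℕ → L2T N} {η : L2T N}
    (hx : Tendsto x atTop (𝓝 η)) {c : ℕ → ℝ≥0∞} {C : ℝ≥0∞} (hc : ∀ j, maxFormR s v L (x j) ≤ c j)
    (hC : Tendsto c atTop (𝓝 C)) : maxFormR s v L η ≤ C := by
  rw [maxFormR_eq_iSup_truncPotential hv.1]
  refine iSup_le fun m => ?_
  refine maxFormR_le_of_tendsto' hL (measurable_truncPotential hv.1 m)
    (lintegral_cellN_periodicInteraction_truncPotential_ne_top hL hv m N) hx (fun j => ?_) hC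
  calc maxFormR s (truncPotential v m) L (x j) ≤ maxFormR s v L (x j) := by
        rw [maxFormR_def, maxFormR_def]
        exact add_le_add (maxForm_truncPotential_le hv.1 L m (x j)) le_rfl
    _ ≤ c j := hc j

/-- **The rewarded functional of a trial state is the rewarded maximal form of its freely embedded class**:
`E_v[Ψ] + s(N - n₀(Ψ)) = maxFormR s v L (ι₀Ψ)` (`s ≥ 0`; depletion dictionary `N - n₀(Ψ) = dep(ι₀Ψ)`). [folklore] -/
theorem rewardedF_eq_maxFormR (hL : 0 < L) (hv : Measurable v) (hs : 0 ≤ s) (Ψ : PeriodicTrialState N L) :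
    periodicEnergy v Ψ + ENNReal.ofReal s * ((N : ℝ≥0∞) - condensateOccupation N L Ψ.ψ) =
      maxFormR s v L (formEmbed hL measurable_zeroProfile (lintegral_periodicInteraction_zero_ne_top N L)
        ⟨graphEmbed hL measurable_zeroProfile (lintegral_periodicInteraction_zero_ne_top N L)
          ⟨Ψ.ψ, Ψ.mem_periodicCore⟩, graphEmbed_mem_formDomain _ _ _ _⟩) := by
  rw [maxFormR_def, maxForm_formEmbed_free_trialState hL hv Ψ,
    natCast_sub_condensateOccupation_eq_ofReal_depletion hL measurable_zeroProfile
      (lintegral_periodicInteraction_zero_ne_top N L) Ψ, ← ENNReal.ofReal_mul hs]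

/-- **The `L²`-Lipschitz bound of the rewarded maximal form in the approximation**: for unit classes `x, ξ`
with `maxForm x ≤ maxForm ξ + ε` and `‖x - ξ‖ ≤ ε`, `maxFormR x ≤ maxFormR ξ + (1 + 2sN)ε` (`s ≥ 0`). [folklore] -/
theorem maxFormR_le_add_of_norm_sub_le (hs : 0 ≤ s) {x ξ : L2T N} (hx1 : ‖x‖ = 1) (hξ1 : ‖ξ‖ = 1) {ε : ℝ}
    (hε : 0 ≤ ε) (hE : maxForm v L x ≤ maxForm v L ξ + ENNReal.ofReal ε) (hdist : ‖x - ξ‖ ≤ ε) :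
    maxFormR s v L x ≤ maxFormR s v L ξ + ENNReal.ofReal ((1 + 2 * s * N) * ε) := by
  have hdep : depletion N x ≤ depletion N ξ + 2 * N * ε := by
    have h := abs_depletion_sub_depletion_le x ξ
    rw [hx1, hξ1] at h
    have h' := (abs_le.1 h).2
    nlinarith [norm_nonneg (x - ξ), (Nat.cast_nonneg N : (0 : ℝ) ≤ N)]
  have hd0 : 0 ≤ depletion N ξ := depletion_nonneg ξ
  calc maxFormR s v L x = maxForm v L x + ENNReal.ofReal (s * depletion N x) := rfl
    _ ≤ (maxForm v L ξ + ENNReal.ofReal ε) + ENNReal.ofReal (s * (depletion N ξ + 2 * N * ε)) :=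
        add_le_add hE (ENNReal.ofReal_le_ofReal (mul_le_mul_of_nonneg_left hdep hs))
    _ = maxFormR s v L ξ + ENNReal.ofReal ((1 + 2 * s * N) * ε) := by
        rw [maxFormR_def, mul_add, ENNReal.ofReal_add (mul_nonneg hs hd0) (by positivity),
          show (1 + 2 * s * N) * ε = ε + s * (2 * N * ε) by ring, ENNReal.ofReal_add hε (by positivity)]
        ring

/-- **The rewarded maximal-form bound, unit classes, hard cores allowed**: `R(s) ≤ maxFormR s v L ξ` for a unit
Bose-symmetric `ξ`, `R(s) = inf_Ψ (E_v[Ψ] + s(N - n₀(Ψ)))` (`s ≥ 0`): the hard-core MaxFormApproximation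
`stub_maxFormApproximationFiniteRange` gives `Φ_ε` with `E_v[Φ_ε] ≤ maxForm ξ + ε`, `‖ι₀Φ_ε - ξ‖ ≤ ε`, and
`E_v[Φ_ε] + s(N - n₀(Φ_ε)) = maxFormR(ι₀Φ_ε) ≤ maxFormR ξ + (1 + 2sN)ε`. [cite: Simon1979Forms, Thm. 2.1] -/
theorem iInf_rewarded_le_maxFormR_of_norm_eq_one (hv : IsRepulsiveFiniteRange v) (hL : 0 < L) (hs : 0 ≤ s)
    {ξ : L2T N} (hξ : ξ ∈ boseSymmetric N) (h1 : ‖ξ‖ = 1) :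
    (⨅ Ψ : PeriodicTrialState N L,
      (periodicEnergy v Ψ + ENNReal.ofReal s * ((N : ℝ≥0∞) - condensateOccupation N L Ψ.ψ))) ≤ maxFormR s v L ξ := by
  by_cases hfin : maxForm v L ξ = ⊤
  · rw [maxFormR_def, hfin, top_add]
    exact le_top
  refine ENNReal.le_of_forall_pos_le_add fun ε hε _ => ?_
  have hc : 0 < 1 + 2 * s * N := by positivity
  have hε' : 0 < (ε : ℝ) / (1 + 2 * s * N) := div_pos (NNReal.coe_pos.2 hε) hc
  obtain ⟨Φ, hE, hdist⟩ := stub_maxFormApproximationFiniteRange v hv N L hL ξ h1 hξ hfin _ hε'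
  have hx1 : ‖(formEmbed hL measurable_zeroProfile (lintegral_periodicInteraction_zero_ne_top N L)
        ⟨graphEmbed hL measurable_zeroProfile (lintegral_periodicInteraction_zero_ne_top N L)
          ⟨Φ.ψ, Φ.mem_periodicCore⟩, graphEmbed_mem_formDomain _ _ _ _⟩)‖ = 1 :=
    norm_formEmbed_graphEmbed_trialState hL measurable_zeroProfile (lintegral_periodicInteraction_zero_ne_top N L) Φ
  have hE' : maxForm v L (formEmbed hL measurable_zeroProfile (lintegral_periodicInteraction_zero_ne_top N L)
        ⟨graphEmbed hL measurable_zeroProfile (lintegral_periodicInteraction_zero_ne_top N L)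
          ⟨Φ.ψ, Φ.mem_periodicCore⟩, graphEmbed_mem_formDomain _ _ _ _⟩) ≤ maxForm v L ξ + ENNReal.ofReal ((ε : ℝ) / (1 + 2 * s * N)) := by
    rw [maxForm_formEmbed_free_trialState hL hv.1 Φ]
    exact hE
  calc (⨅ Ψ : PeriodicTrialState N L,
        (periodicEnergy v Ψ + ENNReal.ofReal s * ((N : ℝ≥0∞) - condensateOccupation N L Ψ.ψ)))
      ≤ periodicEnergy v Φ + ENNReal.ofReal s * ((N : ℝ≥0∞) - condensateOccupation N L Φ.ψ) :=
        iInf_le (fun Ψ : PeriodicTrialState N L =>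
          periodicEnergy v Ψ + ENNReal.ofReal s * ((N : ℝ≥0∞) - condensateOccupation N L Ψ.ψ)) Φ
    _ = maxFormR s v L (formEmbed hL measurable_zeroProfile (lintegral_periodicInteraction_zero_ne_top N L)
        ⟨graphEmbed hL measurable_zeroProfile (lintegral_periodicInteraction_zero_ne_top N L)
          ⟨Φ.ψ, Φ.mem_periodicCore⟩, graphEmbed_mem_formDomain _ _ _ _⟩) := rewardedF_eq_maxFormR hL hv.1 hs Φ
    _ ≤ maxFormR s v L ξ + ENNReal.ofReal ((1 + 2 * s * N) * ((ε : ℝ) / (1 + 2 * s * N))) :=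
        maxFormR_le_add_of_norm_sub_le hs hx1 h1 hε'.le hE' hdist
    _ = maxFormR s v L ξ + ε := by rw [mul_div_cancel₀ _ hc.ne', ENNReal.ofReal_coe_nnreal]

/-- **The rewarded maximal-form bound, hard cores allowed**: `R(s)‖ξ‖² ≤ maxFormR s v L ξ` on the Bose sector,
`R(s) = inf_Ψ (E_v[Ψ] + s(N - n₀(Ψ)))`, `s ≥ 0` (scaling). [cite: Simon1979Forms, Thm. 2.1] -/
theorem iInf_rewarded_mul_le_maxFormR (hv : IsRepulsiveFiniteRange v) (hL : 0 < L) (hs : 0 ≤ s)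
    {η : L2T N} (hη : η ∈ boseSymmetric N) :
    (⨅ Ψ : PeriodicTrialState N L,
      (periodicEnergy v Ψ + ENNReal.ofReal s * ((N : ℝ≥0∞) - condensateOccupation N L Ψ.ψ))) *
        ENNReal.ofReal (‖η‖ ^ 2) ≤ maxFormR s v L η := by
  set R : ℝ≥0∞ := ⨅ Ψ : PeriodicTrialState N L,
      (periodicEnergy v Ψ + ENNReal.ofReal s * ((N : ℝ≥0∞) - condensateOccupation N L Ψ.ψ)) with hRdef
  by_cases h0 : η = 0
  · rw [h0, norm_zero, sq, zero_mul, ENNReal.ofReal_zero, mul_zero]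
    exact bot_le
  have hn : 0 < ‖η‖ := norm_pos_iff.2 h0
  set ξ : L2T N := ((‖η‖⁻¹ : ℝ) : ℂ) • η with hξdef
  have hξ1 : ‖ξ‖ = 1 := by
    rw [hξdef, norm_smul, Complex.norm_real, Real.norm_of_nonneg (inv_nonneg.2 hn.le), inv_mul_cancel₀ hn.ne']
  have hξ : ξ ∈ boseSymmetric N := (boseSymmetric N).smul_mem _ hη
  have hηξ : η = ((‖η‖ : ℝ) : ℂ) • ξ := by
    rw [hξdef, smul_smul, ← Complex.ofReal_mul, mul_inv_cancel₀ hn.ne', Complex.ofReal_one, one_smul]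
  have h : R ≤ maxFormR s v L ξ := iInf_rewarded_le_maxFormR_of_norm_eq_one hv hL hs hξ hξ1
  calc R * ENNReal.ofReal (‖η‖ ^ 2) = ENNReal.ofReal (‖((‖η‖ : ℝ) : ℂ)‖ ^ 2) * R := by
        rw [mul_comm, Complex.norm_real, Real.norm_of_nonneg hn.le]
    _ ≤ ENNReal.ofReal (‖((‖η‖ : ℝ) : ℂ)‖ ^ 2) * maxFormR s v L ξ := mul_le_mul' le_rfl h
    _ = maxFormR s v L η := by rw [← maxFormR_smul, ← hηξ]


/-! ### Part B — the class `𝓜 = {η ∈ boseSymmetric N | maxFormR s v L η ≤ R‖η‖²}` at a finite level `R` -/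

section ClassFacts

variable {R : ℝ≥0∞}

/-- Elements of the class have finite rewarded maximal form (`R < ∞`). [folklore] -/
theorem maxFormR_ne_top_of_le (hR : R ≠ ⊤) {η : L2T N} (hη : maxFormR s v L η ≤ R * ENNReal.ofReal (‖η‖ ^ 2)) :
    maxFormR s v L η ≠ ⊤ :=
  ne_top_of_le_ne_top (ENNReal.mul_ne_top hR ENNReal.ofReal_ne_top) hη

/-- Elements of the class have finite maximal form (`R < ∞`). [folklore] -/
theorem maxForm_ne_top_of_le (hR : R ≠ ⊤) {η : L2T N} (hη : maxFormR s v L η ≤ R * ENNReal.ofReal (‖η‖ ^ 2)) :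
    maxForm v L η ≠ ⊤ :=
  ne_top_of_le_ne_top (maxFormR_ne_top_of_le hR hη) (by rw [maxFormR_def]; exact le_self_add)

/-- The class is closed under scalars. [folklore] -/
theorem smul_mem_classFR (c : ℂ) {η : L2T N}
    (hη : η ∈ boseSymmetric N ∧ maxFormR s v L η ≤ R * ENNReal.ofReal (‖η‖ ^ 2)) :
    c • η ∈ boseSymmetric N ∧ maxFormR s v L (c • η) ≤ R * ENNReal.ofReal (‖c • η‖ ^ 2) := by
  refine ⟨(boseSymmetric N).smul_mem c hη.1, ?_⟩
  rw [maxFormR_smul, norm_smul, mul_pow, ENNReal.ofReal_mul (sq_nonneg _), mul_left_comm]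
  exact mul_le_mul' le_rfl hη.2

/-- **The class is closed under addition**, given the rewarded maximal-form bound `R‖ξ‖² ≤ maxFormR ξ` on the
Bose sector, `s ≥ 0` and `R < ∞` (parallelogram law of `maxFormR`). [folklore] -/
theorem add_mem_classFR (hv : Measurable v) (hs : 0 ≤ s) (hR : R ≠ ⊤)
    (hbound : ∀ ξ : L2T N, ξ ∈ boseSymmetric N → R * ENNReal.ofReal (‖ξ‖ ^ 2) ≤ maxFormR s v L ξ)
    {η ξ : L2T N} (hη : η ∈ boseSymmetric N ∧ maxFormR s v L η ≤ R * ENNReal.ofReal (‖η‖ ^ 2))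
    (hξ : ξ ∈ boseSymmetric N ∧ maxFormR s v L ξ ≤ R * ENNReal.ofReal (‖ξ‖ ^ 2)) :
    η + ξ ∈ boseSymmetric N ∧ maxFormR s v L (η + ξ) ≤ R * ENNReal.ofReal (‖η + ξ‖ ^ 2) := by
  refine ⟨(boseSymmetric N).add_mem hη.1 hξ.1, ?_⟩
  have hlow : R * ENNReal.ofReal (‖η - ξ‖ ^ 2) ≤ maxFormR s v L (η - ξ) :=
    hbound _ ((boseSymmetric N).sub_mem hη.1 hξ.1)
  have hsum : maxFormR s v L (η + ξ) + maxFormR s v L (η - ξ) ≤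
      R * ENNReal.ofReal (‖η + ξ‖ ^ 2) + R * ENNReal.ofReal (‖η - ξ‖ ^ 2) := by
    rw [maxFormR_parallelogram hs hv]
    calc 2 * maxFormR s v L η + 2 * maxFormR s v L ξ
        ≤ 2 * (R * ENNReal.ofReal (‖η‖ ^ 2)) + 2 * (R * ENNReal.ofReal (‖ξ‖ ^ 2)) := by
          gcongr
          · exact hη.2
          · exact hξ.2
      _ = R * ENNReal.ofReal (2 * ‖η‖ ^ 2 + 2 * ‖ξ‖ ^ 2) := by
          rw [ENNReal.ofReal_add (by positivity) (by positivity), ENNReal.ofReal_mul zero_le_two,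
            ENNReal.ofReal_mul zero_le_two, ENNReal.ofReal_ofNat]
          ring
      _ = R * ENNReal.ofReal (‖η + ξ‖ ^ 2 + ‖η - ξ‖ ^ 2) := by
          congr 1
          congr 1
          have h := parallelogram_law_with_norm ℂ η ξ
          simp only [sq]
          linarith [h]
      _ = R * ENNReal.ofReal (‖η + ξ‖ ^ 2) + R * ENNReal.ofReal (‖η - ξ‖ ^ 2) := by
          rw [ENNReal.ofReal_add (sq_nonneg _) (sq_nonneg _), mul_add]
  have hfin : R * ENNReal.ofReal (‖η - ξ‖ ^ 2) ≠ ⊤ := ENNReal.mul_ne_top hR ENNReal.ofReal_ne_top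
  calc maxFormR s v L (η + ξ)
      = maxFormR s v L (η + ξ) + R * ENNReal.ofReal (‖η - ξ‖ ^ 2) - R * ENNReal.ofReal (‖η - ξ‖ ^ 2) :=
        (ENNReal.add_sub_cancel_right hfin).symm
    _ ≤ maxFormR s v L (η + ξ) + maxFormR s v L (η - ξ) - R * ENNReal.ofReal (‖η - ξ‖ ^ 2) :=
        tsub_le_tsub_right (add_le_add le_rfl hlow) _
    _ ≤ R * ENNReal.ofReal (‖η + ξ‖ ^ 2) + R * ENNReal.ofReal (‖η - ξ‖ ^ 2) - R * ENNReal.ofReal (‖η - ξ‖ ^ 2) :=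
        tsub_le_tsub_right hsum _
    _ = R * ENNReal.ofReal (‖η + ξ‖ ^ 2) := ENNReal.add_sub_cancel_right hfin

/-- **`|η|` stays in the class** (`s ≥ 0`): Kato's inequality for the kinetic part, invariance of the potential
part, Beurling–Deny for the depletion (`maxFormR_absLp_le`). [cite: ReedSimonIV1978, Thm XIII.43 (c)⇒(a)] -/
theorem absLp_mem_classFR (hs : 0 ≤ s) {η : L2T N}
    (hη : η ∈ boseSymmetric N ∧ maxFormR s v L η ≤ R * ENNReal.ofReal (‖η‖ ^ 2)) :
    absLp η ∈ boseSymmetric N ∧ maxFormR s v L (absLp η) ≤ R * ENNReal.ofReal (‖absLp η‖ ^ 2) := by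
  refine ⟨compLp_mem_boseSymmetric _ _ hη.1, (maxFormR_absLp_le hs v L η).trans ?_⟩
  rw [norm_absLp]
  exact hη.2

/-- **`conj η` stays in the class** (`s ≥ 0`; the rewarded form is real). [cite: ReedSimonIV1978, Thm XIII.43] -/
theorem conjLp_mem_classFR (hs : 0 ≤ s) {η : L2T N}
    (hη : η ∈ boseSymmetric N ∧ maxFormR s v L η ≤ R * ENNReal.ofReal (‖η‖ ^ 2)) :
    conjLp η ∈ boseSymmetric N ∧ maxFormR s v L (conjLp η) ≤ R * ENNReal.ofReal (‖conjLp η‖ ^ 2) := by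
  refine ⟨compLp_mem_boseSymmetric _ _ hη.1,
    (maxFormR_compLp_le hs lipschitzWith_conjC (by simp) (fun z => by simp) v L η).trans ?_⟩
  rw [conjLp, norm_compLp_eq _ _ (fun z => by simp)]
  exact hη.2

/-- **Diagonal translates stay in the class** (`maxFormR` and the norm are translation invariant, the Bose
sector is translation stable). [folklore] -/
theorem translateLp_mem_classFR (hL : 0 < L) (b : UnitAddTorus (Fin 3)) {η : L2T N}
    (hη : η ∈ boseSymmetric N ∧ maxFormR s v L η ≤ R * ENNReal.ofReal (‖η‖ ^ 2)) :
    translateLp b η ∈ boseSymmetric N ∧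
      maxFormR s v L (translateLp b η) ≤ R * ENNReal.ofReal (‖translateLp b η‖ ^ 2) := by
  refine ⟨translateLp_mem_boseSymmetric b hη.1, ?_⟩
  rw [maxFormR_translateLp hL, norm_translateLp]
  exact hη.2

/-- **The class is closed in `L²`** (`R < ∞`; lower semicontinuity of the rewarded maximal form for hard cores,
`maxFormR_le_of_tendsto_fr`, and closedness of the Bose sector). [folklore] -/
theorem isClosed_classFR (hv : IsRepulsiveFiniteRange v) (hL : 0 < L) (hR : R ≠ ⊤) :
    IsClosed {η : L2T N | η ∈ boseSymmetric N ∧ maxFormR s v L η ≤ R * ENNReal.ofReal (‖η‖ ^ 2)} := by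
  refine isSeqClosed_iff_isClosed.1 fun x η hx hlim => ?_
  refine ⟨isClosed_boseSymmetric.mem_of_tendsto hlim (Eventually.of_forall fun j => (hx j).1), ?_⟩
  refine maxFormR_le_of_tendsto_fr hv hL hlim (fun j => (hx j).2) ?_
  exact ENNReal.Tendsto.const_mul ((ENNReal.continuous_ofReal.tendsto _).comp
    (((continuous_norm.tendsto η).comp hlim).pow 2)) (Or.inr hR)

/-- On the class the bound is an equality: `maxFormR η = R‖η‖²`. [folklore] -/
theorem maxFormR_eq_of_mem_classFR
    (hbound : ∀ ξ : L2T N, ξ ∈ boseSymmetric N → R * ENNReal.ofReal (‖ξ‖ ^ 2) ≤ maxFormR s v L ξ)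
    {η : L2T N} (hη : η ∈ boseSymmetric N ∧ maxFormR s v L η ≤ R * ENNReal.ofReal (‖η‖ ^ 2)) :
    maxFormR s v L η = R * ENNReal.ofReal (‖η‖ ^ 2) :=
  le_antisymm hη.2 (hbound η hη.1)

/-- **Expansion of the rewarded maximal form** along a real line, without `W ∈ L¹`: for classes of finite
maximal form and `s ≥ 0`, `maxFormR(η + tξ) = maxFormR η + 2t(KinB + PotB + s·DepB)(η, ξ) + t² maxFormR ξ` and
`maxFormR(η + tξ) < ∞` (`toReal_maxForm_add_smul_c2` + `depletion_add_ofReal_smul`). [folklore] -/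
theorem toReal_maxFormR_add_smul_fr (hv : Measurable v) (hs : 0 ≤ s) {η ξ : L2T N}
    (hη : maxForm v L η ≠ ⊤) (hξ : maxForm v L ξ ≠ ⊤) (t : ℝ) :
    maxFormR s v L (η + (t : ℂ) • ξ) ≠ ⊤ ∧
    (maxFormR s v L (η + (t : ℂ) • ξ)).toReal = (maxFormR s v L η).toReal +
      2 * t * (maxFormKinB L η ξ + maxFormPotB v L η ξ + s * depletionB N η ξ) +
        t ^ 2 * (maxFormR s v L ξ).toReal := by
  obtain ⟨hfin, heq⟩ := toReal_maxForm_add_smul_c2 hv hη hξ t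
  refine ⟨maxFormR_ne_top_of_maxForm_ne_top s hfin, ?_⟩
  rw [toReal_maxFormR hs hfin, toReal_maxFormR hs hη, toReal_maxFormR hs hξ, heq, depletion_add_ofReal_smul]
  ring

/-- **The rewarded Euler–Lagrange identity, hard cores allowed.** Given the rewarded maximal-form bound on the
Bose sector, `s ≥ 0`, `R < ∞`, an element `η` of the class and a Bose-symmetric direction `ξ` of finite maximal
form: `KinB(η, ξ) + PotB(η, ξ) + s·DepB(η, ξ) = R re⟪η, ξ⟫` (from `R‖η + tξ‖² ≤ maxFormR(η + tξ)` for all real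
`t`, with equality at `t = 0`). [cite: ReedSimonIV1978, Thm. XIII.1] -/
theorem eulerLagrange_classFR (hv : Measurable v) (hs : 0 ≤ s) (hR : R ≠ ⊤)
    (hbound : ∀ ξ : L2T N, ξ ∈ boseSymmetric N → R * ENNReal.ofReal (‖ξ‖ ^ 2) ≤ maxFormR s v L ξ)
    {η ξ : L2T N} (hη : η ∈ boseSymmetric N ∧ maxFormR s v L η ≤ R * ENNReal.ofReal (‖η‖ ^ 2))
    (hξ : ξ ∈ boseSymmetric N) (hξfin : maxForm v L ξ ≠ ⊤) :
    maxFormKinB L η ξ + maxFormPotB v L η ξ + s * depletionB N η ξ = R.toReal * (⟪η, ξ⟫_ℂ).re := by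
  have hηfin : maxForm v L η ≠ ⊤ := maxForm_ne_top_of_le hR hη.2
  have hη0 : (maxFormR s v L η).toReal = R.toReal * ‖η‖ ^ 2 := by
    rw [maxFormR_eq_of_mem_classFR hbound hη, ENNReal.toReal_mul, ENNReal.toReal_ofReal (sq_nonneg _)]
  -- the inequality along the line `η + tξ`
  have hline : ∀ t : ℝ, R.toReal * ‖η + (t : ℂ) • ξ‖ ^ 2 ≤ (maxFormR s v L (η + (t : ℂ) • ξ)).toReal := by
    intro t
    have hmem : η + (t : ℂ) • ξ ∈ boseSymmetric N := (boseSymmetric N).add_mem hη.1 ((boseSymmetric N).smul_mem _ hξ)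
    have h := hbound _ hmem
    have h2 := ENNReal.toReal_mono (toReal_maxFormR_add_smul_fr hv hs hηfin hξfin t).1 h
    rwa [ENNReal.toReal_mul, ENNReal.toReal_ofReal (sq_nonneg _)] at h2
  have hpoly : ∀ t : ℝ, 0 ≤ ((maxFormR s v L ξ).toReal - R.toReal * ‖ξ‖ ^ 2) * t ^ 2 +
      (2 * (maxFormKinB L η ξ + maxFormPotB v L η ξ + s * depletionB N η ξ - R.toReal * (⟪η, ξ⟫_ℂ).re)) * t := by
    intro t
    have h := hline t
    rw [(toReal_maxFormR_add_smul_fr hv hs hηfin hξfin t).2, hη0, norm_add_ofReal_smul_sq] at h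
    nlinarith [h]
  have h0 := eq_zero_of_forall_sq_add_mul_nonneg hpoly
  linarith

end ClassFacts

end Summit.AtomisticToContinuum.BoseEinsteinCondensation.Cruxes.RewardChordBound.Birth.RewardedClassFR

namespace Summit.AtomisticToContinuum.BoseEinsteinCondensation.Cruxes.RewardChordBound.Birth

open Literature.MathematicalPhysics.QuantumManyBody.BoseGas
open Summit.AtomisticToContinuum.BoseEinsteinCondensation.Cruxes.RewardChordBound.Birth.RewardedClassFR

-- The measure on `ℝ/ℤ` is the Haar PROBABILITY measure, as in `PeriodicFormDomain.lean`.
attribute [local instance] Literature.MathematicalPhysics.QuantumManyBody.BoseGas.formDomain_measureSpace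
  Literature.MathematicalPhysics.QuantumManyBody.BoseGas.formDomain_isProbabilityMeasure
  Literature.MathematicalPhysics.QuantumManyBody.BoseGas.formDomain_isProbabilityMeasure_pi

/-- **Registered sub-goal of stub `stub_rewardedClassFR` (helper file): the rewarded maximal-form ground-state
class for finite-range potentials, hard cores allowed, parts (a), (b), (c), (e), (f).** For `L > 0`, `s ≥ 0`, a
repulsive finite-range `v` and `R := inf_Ψ (E_v[Ψ] + s(N - n₀(Ψ))) < ⊤`, with
`M := {η ∈ boseSymmetric N | maxFormR s v L η ≤ R‖η‖²}`: the rewarded max-form bound on the Bose sector, the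
rewarded Euler–Lagrange identity at elements of `M`, closure of `M` under `+`, `ℂ•`, `|·|`, `conj`, finiteness of
the maximal form on `M`, stability of `M` under the diagonal translations, and closedness of `M` in `L²`.
[cite: ReedSimonIV1978, §XIII.12 and Thm XIII.64; Simon1979Forms, Thm. 2.1] -/
theorem stub_rewardedClassFR_Helpers :
    ∀ (N : ℕ) (L : ℝ) (v : ℝ → ENNReal) (s : ℝ) (hL : 0 < L), Literature.MathematicalPhysics.QuantumManyBody.BoseGas.IsRepulsiveFiniteRange v → 0 ≤ s → let R : ENNReal := ⨅ Ψ : Literature.MathematicalPhysics.QuantumManyBody.BoseGas.PeriodicTrialState N L, (Literature.MathematicalPhysics.QuantumManyBody.BoseGas.periodicEnergy v Ψ + ENNReal.ofReal s * ((N : ENNReal) - Literature.MathematicalPhysics.QuantumManyBody.BoseGas.condensateOccupation N L Ψ.ψ)); R ≠ ⊤ → let M : Set (MeasureTheory.Lp ℂ 2 (MeasureTheory.Measure.pi fun _ : Fin N × Fin 3 => (AddCircle.haarAddCircle : MeasureTheory.Measure UnitAddCircle))) := {η | η ∈ Literature.MathematicalPhysics.QuantumManyBody.BoseGas.boseSymmetric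 N ∧ Literature.MathematicalPhysics.QuantumManyBody.BoseGas.maxFormR s v L η ≤ R * ENNReal.ofReal (‖η‖ ^ 2)}; (∀ ξ : MeasureTheory.Lp ℂ 2 (MeasureTheory.Measure.pi fun _ : Fin N × Fin 3 => (AddCircle.haarAddCircle : MeasureTheory.Measure UnitAddCircle)), ξ ∈ Literature.MathematicalPhysics.QuantumManyBody.BoseGas.boseSymmetric N → R * ENNReal.ofReal (‖ξ‖ ^ 2) ≤ Literature.MathematicalPhysics.QuantumManyBody.BoseGas.maxFormR s v L ξ) ∧ (∀ η ∈ M, ∀ ξ : MeasureTheory.Lp ℂ 2 (MeasureTheory.Measure.pi fun _ : Fin N × Fin 3 => (AddCircle.haarAddCircle : MeasureTheory.Measure UnitAddCircle)), ξ ∈ Literature.MathematicalPhysics.QuantumManyBody.BoseGas.boseSymmetric N → Literature.MathematicalPhysics.QuantumManyBody.BoseGas.maxForm v L ξ ≠ ⊤ → Literature.MathematicalPhysics.QuantumManyBody.BoseGas.maxFormKinB L η ξ + Literature.MathematicalPhysics.QuantumManyBody.BoseGas.maxFormPotB v L η ξ + s * Literature.MathematicalPhysics.QuantumManyBody.BoseGas.depletionB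 N η ξ = R.toReal * (⟪η, ξ⟫_ℂ).re) ∧ (∀ η ∈ M, ∀ θ ∈ M, η + θ ∈ M) ∧ (∀ η ∈ M, ∀ c : ℂ, c • η ∈ M) ∧ (∀ η ∈ M, Literature.MathematicalPhysics.QuantumManyBody.BoseGas.absLp η ∈ M) ∧ (∀ η ∈ M, Literature.MathematicalPhysics.QuantumManyBody.BoseGas.conjLp η ∈ M) ∧ (∀ η ∈ M, Literature.MathematicalPhysics.QuantumManyBody.BoseGas.maxForm v L η ≠ ⊤) ∧ (∀ (b : UnitAddTorus (Fin 3)) (η : MeasureTheory.Lp ℂ 2 (MeasureTheory.Measure.pi fun _ : Fin N × Fin 3 => (AddCircle.haarAddCircle : MeasureTheory.Measure UnitAddCircle))), η ∈ M → Literature.MathematicalPhysics.QuantumManyBody.BoseGas.translateLp b η ∈ M) ∧ IsClosed M := by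
  intro N L v s hL hv hs R hR M
  have hbound : ∀ ξ : Lp ℂ 2 (volume : Measure (UnitAddTorus (Fin N × Fin 3))), ξ ∈ boseSymmetric N →
      R * ENNReal.ofReal (‖ξ‖ ^ 2) ≤ maxFormR s v L ξ := fun ξ hξ =>
    iInf_rewarded_mul_le_maxFormR hv hL hs hξ
  refine ⟨hbound, ?_, ?_, ?_, ?_, ?_, ?_, ?_, ?_⟩
  · intro η hη ξ hξ hξfin
    exact eulerLagrange_classFR hv.1 hs hR hbound hη hξ hξfin
  · intro η hη θ hθ
    exact add_mem_classFR hv.1 hs hR hbound hη hθ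
  · intro η hη c
    exact smul_mem_classFR c hη
  · intro η hη
    exact absLp_mem_classFR hs hη
  · intro η hη
    exact conjLp_mem_classFR hs hη
  · intro η hη
    exact maxForm_ne_top_of_le hR hη.2
  · intro b η hη
    exact translateLp_mem_classFR hL b hη
  · exact isClosed_classFR hv hL hR

end Summit.AtomisticToContinuum.BoseEinsteinCondensation.Cruxes.RewardChordBound.Birth

end
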